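import Literature.AlgebraicGeometry.Frobenioids.Cor411iiAssemblyFSM
import Literature.AlgebraicGeometry.Frobenioids.Cor411iiiOfFSMType
import Literature.AlgebraicGeometry.Frobenioids.Cor411iOfFSMType
import Literature.AlgebraicGeometry.Frobenioids.PadicFrobenioidFrobeniusCompact
import Literature.AlgebraicGeometry.Frobenioids.PadicFrobenioidStandardType
import Literature.AlgebraicGeometry.Frobenioids.PadicFrobenioidIsotropic
import Literature.AlgebraicGeometry.Frobenioids.PadicFrobenioidCZeroSlim
import Literature.AnabelianGeometry.EtaleTheta.MonoprimeStructure
import HarnessLib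

/-!
# Frobenioids I, Corollary 4.11 (i)–(iv) at the `p`-adic Frobenioids of [FrdII] Example 1.1 — over slim bases of
# FSM-type, and hypothesis-free at THE printed `C₀` over `D₀ = B(G_{ℚ_p})⁰`

Mochizuki, *The geometry of Frobenioids I: the general theory*, Kyushu J. Math. **62** (2008) 293–400,
Corollary 4.11 pp. 91–92 (category-theoreticity of the base category, of the divisor monoid over it and of the
functor to the elementary Frobenioid — the most cited item of [FrdI] in IUT I–IV)
[cite: MochizukiFrdI2008, Cor. 4.11 p.91], applied at Mochizuki, *The geometry of Frobenioids II:
poly-Frobenioids*, Kyushu J. Math. **62** (2008) 401–460, Example 1.1 (i)/(ii) pp. 7–8 and Theorem 1.2 (i) p. 9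
[cite: MochizukiFrdII2008, Ex 1.1 (ii) p.8] [cite: MochizukiFrdII2008, Thm 1.2 (i) p.9].

PROOF-ONLY file (node FrdI:Cor4.11, genuine-data instance at the LOCAL Frobenioids; seat abc-iut-w4-d109; companion
of `Thm49Padic.lean` and of seat abc-iut-L1-d1's arithmetic files `BaseSectionsOfObjectsCor57Arith.lean` /
`ArithmeticFrobenioidDivisorTransport.lean`), 0 definitions. For `p`-adic Frobenioid data
`d_i : PadicFrd.Datum D_i p_i` over connected, totally epimorphic bases `D_i` of FSM-type, the inputs of the cell's
Cor. 4.11 closers are theorems of the tree: `C_i` Frobenioids (`PadicFrd.Datum.isFrobenioid_of_isOfFSMType`), `Φ_i`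
perf-factorial (monoprime, `MonoprimeStructure.isPerfFactorial`), `C_i` of standard type and not of group-like type
([FrdII] Thm. 1.2 (i); `thm12_isOfStandardType_of_isOfFSMType`, `thm12_not_isGroupLike`), of rationally standard
type at THE Def. 4.5 (iii) parameters (`isOfRationallyStandardType_rsParams_of_isOfFSMType`), and — the one
hypothesis of Cor. 4.11 that is NOT automatic — `D_i` Div-slim, which holds when `D_i` is SLIM ([FrdI] Def. 4.5
(iv) "if `D` is slim, then it is Div-slim", `PreFrobenioidData.isDivSlim_of_isSlim`), in particular at THE base
`D₀ = B(G_{ℚ_p})⁰` ([FrdII] Ex. 1.1 (i) "a slim base category"; `PadicFrd.dZero_isSlim`, seat abc-iut-L1-d8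
lineage via [AbsAnab] slimness of `G_{ℚ_p}`). Hence, for EVERY equivalence `Ψ : C₁ ⥲ C₂`:

* `PadicFrd.cor411ii_padic` — the typed Cor. 4.11 (ii) (its antecedent `Cor411Setting` kept) over FSM bases;
  `cor411Setting_padic` — that antecedent HOLDS over slim FSM bases; `exists_oneUniqueSquare_base_padic` — so
  `Ψ` induces a `1`-unique `Ψ^Base : D₁ ⥲ D₂`;
* `PadicFrd.cor411iii_padic`, `cor411iv_padic` — the typed Cor. 4.11 (iii)/(iv) at ANY parameters over FSM bases
  (seat abc-iut-L1-t14's closers fed with (ii)); `exists_divisorTransport_padic` / `exists_cor411iv_data_padic` —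
  their conclusions outright over slim FSM bases: `Ψ^Base` with `Ψ^Φ : Φ₁ ⥲ Φ₂` over it, the `1`-commutative
  diagram `(Base, Div, deg_Fr)`;
* `PadicFrd.exists_cor411i_padic` — Cor. 4.11 (i) (`Ψ^istr`, `Ψ^un-tr`) over slim FSM bases;
* at THE `C₀` (`PadicFrd.CZeroGal p`), all of the above with NOTHING assumed (`…_czeroGal`).

No statement of either paper is restated or strengthened; nothing here bears on, or takes a side on,
[IUTchIII] Cor. 3.12.
-/

noncomputable section

namespace Literature.AlgebraicGeometry.Frobenioids

open CategoryTheory Opposite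
open PreFrobenioid PreFrobenioidData

namespace PadicFrd

universe v u

section TwoData

variable {D₁ : Type u} [Category.{v} D₁] {D₂ : Type u} [Category.{v} D₂]
variable {p₁ p₂ : ℕ} [Fact p₁.Prime] [Fact p₂.Prime]
variable (d₁ : Datum D₁ p₁) (d₂ : Datum D₂ p₂)

/-! ### The Cor. 4.11 hypothesis package at a pair of `p`-adic Frobenioids -/

/-- **The standing hypotheses of [FrdI] Cor. 4.11 HOLD for every equivalence `Ψ : C₁ ⥲ C₂` between `p`-adic
Frobenioids over SLIM bases of FSM-type**: `D_i` Div-slim (slim ⇒ Div-slim, Def. 4.5 (iv)), `C_i` of standard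
type ([FrdII] Thm. 1.2 (i)), and hypothesis (b) "if `C₁`, `C₂` are of group-like type …" IDLE (its antecedent is
refuted: a `p`-adic Frobenioid is not of group-like type, `Φ ≠ 0`). [cite: MochizukiFrdI2008, Cor. 4.11 p.91] -/
theorem cor411Setting_padic (hD₁ : IsOfFSMType D₁) (hD₂ : IsOfFSMType D₂) (hsl₁ : IsSlim D₁) (hsl₂ : IsSlim D₂)
    (Ψ : d₁.frobenioid ≌ d₂.frobenioid) :
    (ModelFrobenioid.data d₁.Φ d₁.B d₁.divB).Cor411Setting (ModelFrobenioid.data d₂.Φ d₂.B d₂.divB) Ψ where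
  divSlim := ⟨PreFrobenioidData.isDivSlim_of_isSlim _ hsl₁, PreFrobenioidData.isDivSlim_of_isSlim _ hsl₂⟩
  standard := ⟨d₁.thm12_isOfStandardType_of_isOfFSMType hD₁, d₂.thm12_isOfStandardType_of_isOfFSMType hD₂⟩
  hypB h₁ _ := absurd h₁ fun h =>
    d₁.thm12_not_isGroupLike fun X => (ofFunctor_isGroupLikeObj d₁.structureFunctor X).mp (h.obj X)

/-! ### Corollary 4.11 (ii) -/

/-- **[FrdI] Cor. 4.11 (ii) AS TYPED for every equivalence `Ψ : C₁ ⥲ C₂` of `p`-adic Frobenioids over bases of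
FSM-type** (seat abc-iut-L1-d6's FSM closer `cor411ii_ofFunctor_of_isOfFSMType`; `Φ_i` perf-factorial since
monoprime). [cite: MochizukiFrdI2008, Cor. 4.11 (ii) p.91] -/
theorem cor411ii_padic (hD₁ : IsOfFSMType D₁) (hD₂ : IsOfFSMType D₂) (Ψ : d₁.frobenioid ≌ d₂.frobenioid) :
    (ModelFrobenioid.data d₁.Φ d₁.B d₁.divB).Cor411ii (ModelFrobenioid.data d₂.Φ d₂.B d₂.divB) Ψ :=
  cor411ii_ofFunctor_of_isOfFSMType (d₁.isFrobenioid_of_isOfFSMType hD₁) (d₂.isFrobenioid_of_isOfFSMType hD₂) Ψ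
    (fun _ => Literature.AnabelianGeometry.EtaleTheta.MonoprimeStructure.isPerfFactorial (d₁.isMonoprime _))
    (fun _ => Literature.AnabelianGeometry.EtaleTheta.MonoprimeStructure.isPerfFactorial (d₂.isMonoprime _))
    hD₁ hD₂

/-- **The `1`-unique `Ψ^Base : D₁ ⥲ D₂` induced by `Ψ`** (Cor. 4.11 (ii) p. 91), for `p`-adic Frobenioids over
slim bases of FSM-type: for every `Ψ : C₁ ⥲ C₂` there is `Ψ^Base` with a `1`-unique `1`-commutative square over
the base functors, and the composites `C₁ → D₂` are rigid. [cite: MochizukiFrdI2008, Cor. 4.11 (ii) p.91] -/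
theorem exists_oneUniqueSquare_base_padic (hD₁ : IsOfFSMType D₁) (hD₂ : IsOfFSMType D₂) (hsl₁ : IsSlim D₁)
    (hsl₂ : IsSlim D₂) (Ψ : d₁.frobenioid ≌ d₂.frobenioid) :
    ∃ ΨBase : D₁ ⥤ D₂,
      OneUniqueSquare Ψ.functor (ModelFrobenioid.data d₁.Φ d₁.B d₁.divB).base
          (ModelFrobenioid.data d₂.Φ d₂.B d₂.divB).base ΨBase ∧
        IsRigidFunctor (Ψ.functor ⋙ (ModelFrobenioid.data d₂.Φ d₂.B d₂.divB).base) ∧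
          IsRigidFunctor ((ModelFrobenioid.data d₁.Φ d₁.B d₁.divB).base ⋙ ΨBase) := by
  obtain ⟨ΨBase, hsq, hrig⟩ := cor411ii_padic d₁ d₂ hD₁ hD₂ Ψ (cor411Setting_padic d₁ d₂ hD₁ hD₂ hsl₁ hsl₂ Ψ)
  exact ⟨ΨBase, hsq, hrig hsl₁ hsl₂⟩

/-! ### Corollary 4.11 (iii) -/

/-- **[FrdI] Cor. 4.11 (iii) AS TYPED, at ANY Def. 4.5 (iii) parameters, for every equivalence of `p`-adic
Frobenioids over bases of FSM-type** (seat abc-iut-L1-t14's closer `cor411iii_of_cor411ii_of_isOfFSMType` fed with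
`cor411ii_padic`; the rationality binder is [FrdII] Thm. 1.2 (i) at THE parameters).
[cite: MochizukiFrdI2008, Cor. 4.11 (iii) p.92] -/
theorem cor411iii_padic (hD₁ : IsOfFSMType D₁) (hD₂ : IsOfFSMType D₂) (Ψ : d₁.frobenioid ≌ d₂.frobenioid)
    (R₁ : (ModelFrobenioid.data d₁.Φ d₁.B d₁.divB).RSParams)
    (R₂ : (ModelFrobenioid.data d₂.Φ d₂.B d₂.divB).RSParams) :
    (ModelFrobenioid.data d₁.Φ d₁.B d₁.divB).Cor411iii (ModelFrobenioid.data d₂.Φ d₂.B d₂.divB) Ψ R₁ R₂ :=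
  FrdI.cor411iii_of_cor411ii_of_isOfFSMType (d₁.isFrobenioid_of_isOfFSMType hD₁) (d₂.isFrobenioid_of_isOfFSMType hD₂)
    hD₁ hD₂
    (fun _ => Literature.AnabelianGeometry.EtaleTheta.MonoprimeStructure.isPerfFactorial (d₁.isMonoprime _))
    (fun _ => Literature.AnabelianGeometry.EtaleTheta.MonoprimeStructure.isPerfFactorial (d₂.isMonoprime _))
    (d₁.isOfRationallyStandardType_rsParams_of_isOfFSMType hD₁).rational Ψ R₁ R₂ (cor411ii_padic d₁ d₂ hD₁ hD₂ Ψ)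

/-- **The conclusion of [FrdI] Cor. 4.11 (iii) outright — the divisor-monoid transport over the base — for
`p`-adic Frobenioids over slim bases of FSM-type**: for every `Ψ : C₁ ⥲ C₂` there are a `1`-unique
`Ψ^Base : D₁ ⥲ D₂` and an isomorphism of functors `Ψ^Φ : Φ₁ ⥲ Φ₂` lying over `Ψ^Base` (monoid isomorphisms
`Φ₁(X) ≃* Φ₂(Ψ^Base X)` natural in `X ∈ Ob(D₁)`) — the antecedents being `cor411Setting_padic` and [FrdII]
Thm. 1.2 (i) at THE parameters. [cite: MochizukiFrdI2008, Cor. 4.11 (iii) p.92] -/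
theorem exists_divisorTransport_padic (hD₁ : IsOfFSMType D₁) (hD₂ : IsOfFSMType D₂) (hsl₁ : IsSlim D₁)
    (hsl₂ : IsSlim D₂) (Ψ : d₁.frobenioid ≌ d₂.frobenioid) :
    ∃ ΨBase : D₁ ⥤ D₂,
      OneUniqueSquare Ψ.functor (ModelFrobenioid.data d₁.Φ d₁.B d₁.divB).base
          (ModelFrobenioid.data d₂.Φ d₂.B d₂.divB).base ΨBase ∧
        Nonempty (DivisorMonoidIsoOverBase (ModelFrobenioid.data d₁.Φ d₁.B d₁.divB)
          (ModelFrobenioid.data d₂.Φ d₂.B d₂.divB) ΨBase) :=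
  cor411iii_padic d₁ d₂ hD₁ hD₂ Ψ _ _ (cor411Setting_padic d₁ d₂ hD₁ hD₂ hsl₁ hsl₂ Ψ)
    (d₁.isOfRationallyStandardType_rsParams_of_isOfFSMType hD₁)
    (d₂.isOfRationallyStandardType_rsParams_of_isOfFSMType hD₂)

/-! ### Corollary 4.11 (iv) -/

/-- **[FrdI] Cor. 4.11 (iv) AS TYPED, at ANY parameters, for every equivalence of `p`-adic Frobenioids over
bases of FSM-type** (seat abc-iut-L1-t14's closer `cor411iv_of_cor411ii_of_isOfFSMType`; `C₁` not of group-like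
type by [FrdII] Thm. 1.2 (i)). [cite: MochizukiFrdI2008, Cor. 4.11 (iv) p.92] -/
theorem cor411iv_padic (hD₁ : IsOfFSMType D₁) (hD₂ : IsOfFSMType D₂) (Ψ : d₁.frobenioid ≌ d₂.frobenioid)
    (R₁ : (ModelFrobenioid.data d₁.Φ d₁.B d₁.divB).RSParams)
    (R₂ : (ModelFrobenioid.data d₂.Φ d₂.B d₂.divB).RSParams) :
    (ModelFrobenioid.data d₁.Φ d₁.B d₁.divB).Cor411iv (ModelFrobenioid.data d₂.Φ d₂.B d₂.divB) Ψ R₁ R₂ :=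
  FrdI.cor411iv_of_cor411ii_of_isOfFSMType (d₁.isFrobenioid_of_isOfFSMType hD₁) (d₂.isFrobenioid_of_isOfFSMType hD₂)
    hD₁ hD₂
    (fun _ => Literature.AnabelianGeometry.EtaleTheta.MonoprimeStructure.isPerfFactorial (d₁.isMonoprime _))
    (fun _ => Literature.AnabelianGeometry.EtaleTheta.MonoprimeStructure.isPerfFactorial (d₂.isMonoprime _))
    (fun h => d₁.thm12_not_isGroupLike fun X => (ofFunctor_isGroupLikeObj d₁.structureFunctor X).mp (h.obj X))
    (d₁.isOfRationallyStandardType_rsParams_of_isOfFSMType hD₁).rational Ψ R₁ R₂ (cor411ii_padic d₁ d₂ hD₁ hD₂ Ψ)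

/-- **The conclusion of [FrdI] Cor. 4.11 (iv) outright for `p`-adic Frobenioids over slim bases of FSM-type**
(category-theoreticity of the functor `C → F_Φ` to the elementary Frobenioid): for every `Ψ : C₁ ⥲ C₂` there are
an equivalence `Ψ^Base`, `Ψ^Φ` over it and `η : Base₂ ∘ Ψ ≅ Ψ^Base ∘ Base₁` with `Ψ` preserving Frobenius degrees
and `Div(Ψ φ) = η_A^* Ψ^Φ(Div φ)` for every arrow `φ` of `C₁`; and (slim bases) the `D₂`-valued composites are
rigid. [cite: MochizukiFrdI2008, Cor. 4.11 (iv) p.92] -/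
theorem exists_cor411iv_data_padic (hD₁ : IsOfFSMType D₁) (hD₂ : IsOfFSMType D₂) (hsl₁ : IsSlim D₁)
    (hsl₂ : IsSlim D₂) (Ψ : d₁.frobenioid ≌ d₂.frobenioid) :
    ∃ (ΨBase : D₁ ⥤ D₂)
      (E : DivisorMonoidIsoOverBase (ModelFrobenioid.data d₁.Φ d₁.B d₁.divB)
        (ModelFrobenioid.data d₂.Φ d₂.B d₂.divB) ΨBase)
      (η : Ψ.functor ⋙ (ModelFrobenioid.data d₂.Φ d₂.B d₂.divB).base ≅
        (ModelFrobenioid.data d₁.Φ d₁.B d₁.divB).base ⋙ ΨBase),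
      ΨBase.IsEquivalence ∧
        PreservesDegFr (ModelFrobenioid.data d₁.Φ d₁.B d₁.divB) (ModelFrobenioid.data d₂.Φ d₂.B d₂.divB) Ψ ∧
        (∀ ⦃A B : d₁.frobenioid⦄ (φ : A ⟶ B),
          (ModelFrobenioid.data d₂.Φ d₂.B d₂.divB).div (Ψ.functor.map φ) =
            (ModelFrobenioid.data d₂.Φ d₂.B d₂.divB).pull (η.hom.app A)
              (E.iso ((ModelFrobenioid.data d₁.Φ d₁.B d₁.divB).base.obj A)
                ((ModelFrobenioid.data d₁.Φ d₁.B d₁.divB).div φ))) ∧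
        (IsRigidFunctor (Ψ.functor ⋙ (ModelFrobenioid.data d₂.Φ d₂.B d₂.divB).base) ∧
          IsRigidFunctor ((ModelFrobenioid.data d₁.Φ d₁.B d₁.divB).base ⋙ ΨBase)) := by
  obtain ⟨ΨBase, E, η, hequiv, hdeg, hdiv, hrig⟩ := cor411iv_padic d₁ d₂ hD₁ hD₂ Ψ _ _
    (cor411Setting_padic d₁ d₂ hD₁ hD₂ hsl₁ hsl₂ Ψ) (d₁.isOfRationallyStandardType_rsParams_of_isOfFSMType hD₁)
    (d₂.isOfRationallyStandardType_rsParams_of_isOfFSMType hD₂)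
  exact ⟨ΨBase, E, η, hequiv, hdeg, hdiv, hrig hsl₁ hsl₂⟩

/-! ### Corollary 4.11 (i) -/

/-- **[FrdI] Cor. 4.11 (i) for `p`-adic Frobenioids over slim bases of FSM-type**: for every `Ψ : C₁ ⥲ C₂` there
is the restriction `Ψ^istr : C₁^istr ⥲ C₂^istr` (Thm. 3.4 (i)) together with a `1`-unique
`Ψ^un-tr : C₁^un-tr ⥲ C₂^un-tr` `1`-commuting with the unit-trivializations, both composites rigid — the typed
`Cor411i` for `Ψ^istr` (seat abc-iut-L1-d6/w4-d105 closer `cor411i_ofFunctor_of_isOfFSMType` at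
`cor411Setting_padic`). [cite: MochizukiFrdI2008, Cor. 4.11 (i) p.91] -/
theorem exists_cor411i_padic (hD₁ : IsOfFSMType D₁) (hD₂ : IsOfFSMType D₂) (hsl₁ : IsSlim D₁) (hsl₂ : IsSlim D₂)
    (Ψ : d₁.frobenioid ≌ d₂.frobenioid) :
    ∃ Ψistr : (ModelFrobenioid.data d₁.Φ d₁.B d₁.divB).Istr ≌ (ModelFrobenioid.data d₂.Φ d₂.B d₂.divB).Istr,
      Ψistr.functor ⋙ (ModelFrobenioid.data d₂.Φ d₂.B d₂.divB).istrι =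
          (ModelFrobenioid.data d₁.Φ d₁.B d₁.divB).istrι ⋙ Ψ.functor ∧
        (ModelFrobenioid.data d₁.Φ d₁.B d₁.divB).Cor411i (ModelFrobenioid.data d₂.Φ d₂.B d₂.divB) Ψ
          Ψistr.functor :=
  cor411i_ofFunctor_of_isOfFSMType (d₁.isFrobenioid_of_isOfFSMType hD₁) (d₂.isFrobenioid_of_isOfFSMType hD₂)
    hD₁ hD₂
    (fun _ => Literature.AnabelianGeometry.EtaleTheta.MonoprimeStructure.isPerfFactorial (d₁.isMonoprime _))
    (fun _ => Literature.AnabelianGeometry.EtaleTheta.MonoprimeStructure.isPerfFactorial (d₂.isMonoprime _))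
    Ψ (cor411Setting_padic d₁ d₂ hD₁ hD₂ hsl₁ hsl₂ Ψ)

end TwoData

/-! ### At THE printed `C₀` over `D₀ = B(G_{ℚ_p})⁰`: nothing assumed -/

section CZero

variable (p₁ p₂ : ℕ) [Fact p₁.Prime] [Fact p₂.Prime]

/-- **[FrdI] Cor. 4.11's hypothesis package HOLDS at THE `C₀`'s, for every `Ψ : C₀(p₁) ⥲ C₀(p₂)`** (`D₀` slim
and of FSM-type: `dZero_isSlim`, `dZero_isOfFSMType`). [cite: MochizukiFrdI2008, Cor. 4.11 p.91]
[cite: MochizukiFrdII2008, Ex 1.1 (i) p.7] -/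
theorem cor411Setting_czeroGal (Ψ : CZeroGal p₁ ≌ CZeroGal p₂) :
    (ModelFrobenioid.data (Datum.zeroGal p₁).Φ (Datum.zeroGal p₁).B (Datum.zeroGal p₁).divB).Cor411Setting
      (ModelFrobenioid.data (Datum.zeroGal p₂).Φ (Datum.zeroGal p₂).B (Datum.zeroGal p₂).divB) Ψ :=
  cor411Setting_padic _ _ (dZero_isOfFSMType p₁) (dZero_isOfFSMType p₂) (dZero_isSlim p₁) (dZero_isSlim p₂) Ψ

/-- **[FrdI] Cor. 4.11 (ii) at THE `C₀`'s, no hypothesis**: every `Ψ : C₀(p₁) ⥲ C₀(p₂)` induces a `1`-unique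
`Ψ^Base : D₀(p₁) ⥲ D₀(p₂)` over the base functors, with rigid composites.
[cite: MochizukiFrdI2008, Cor. 4.11 (ii) p.91] [cite: MochizukiFrdII2008, Ex 1.1 (i) p.7] -/
theorem exists_oneUniqueSquare_base_czeroGal (Ψ : CZeroGal p₁ ≌ CZeroGal p₂) :
    ∃ ΨBase : DZero p₁ ⥤ DZero p₂,
      OneUniqueSquare Ψ.functor
          (ModelFrobenioid.data (Datum.zeroGal p₁).Φ (Datum.zeroGal p₁).B (Datum.zeroGal p₁).divB).base
          (ModelFrobenioid.data (Datum.zeroGal p₂).Φ (Datum.zeroGal p₂).B (Datum.zeroGal p₂).divB).base ΨBase ∧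
        IsRigidFunctor (Ψ.functor ⋙
            (ModelFrobenioid.data (Datum.zeroGal p₂).Φ (Datum.zeroGal p₂).B (Datum.zeroGal p₂).divB).base) ∧
          IsRigidFunctor
            ((ModelFrobenioid.data (Datum.zeroGal p₁).Φ (Datum.zeroGal p₁).B (Datum.zeroGal p₁).divB).base ⋙
              ΨBase) :=
  exists_oneUniqueSquare_base_padic _ _ (dZero_isOfFSMType p₁) (dZero_isOfFSMType p₂) (dZero_isSlim p₁)
    (dZero_isSlim p₂) Ψ

/-- **[FrdI] Cor. 4.11 (iii) at THE `C₀`'s, no hypothesis**: every `Ψ : C₀(p₁) ⥲ C₀(p₂)` induces `Ψ^Base` and an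
isomorphism of functors `Ψ^Φ : Φ₀ ⥲ Φ₀` lying over `Ψ^Base`. [cite: MochizukiFrdI2008, Cor. 4.11 (iii) p.92]
[cite: MochizukiFrdII2008, Ex 1.1 (i) p.7] -/
theorem exists_divisorTransport_czeroGal (Ψ : CZeroGal p₁ ≌ CZeroGal p₂) :
    ∃ ΨBase : DZero p₁ ⥤ DZero p₂,
      OneUniqueSquare Ψ.functor
          (ModelFrobenioid.data (Datum.zeroGal p₁).Φ (Datum.zeroGal p₁).B (Datum.zeroGal p₁).divB).base
          (ModelFrobenioid.data (Datum.zeroGal p₂).Φ (Datum.zeroGal p₂).B (Datum.zeroGal p₂).divB).base ΨBase ∧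
        Nonempty (DivisorMonoidIsoOverBase
          (ModelFrobenioid.data (Datum.zeroGal p₁).Φ (Datum.zeroGal p₁).B (Datum.zeroGal p₁).divB)
          (ModelFrobenioid.data (Datum.zeroGal p₂).Φ (Datum.zeroGal p₂).B (Datum.zeroGal p₂).divB) ΨBase) :=
  exists_divisorTransport_padic _ _ (dZero_isOfFSMType p₁) (dZero_isOfFSMType p₂) (dZero_isSlim p₁)
    (dZero_isSlim p₂) Ψ

/-- **[FrdI] Cor. 4.11 (iv) AS TYPED at THE `C₀`'s and THE parameters, its antecedents all theorems** (so the
`1`-commutative diagram `(Base, Div, deg_Fr)` follows for every `Ψ` by `exists_cor411iv_data_padic`).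
[cite: MochizukiFrdI2008, Cor. 4.11 (iv) p.92] [cite: MochizukiFrdII2008, Ex 1.1 (i) p.7] -/
theorem cor411iv_czeroGal (Ψ : CZeroGal p₁ ≌ CZeroGal p₂) :
    (ModelFrobenioid.data (Datum.zeroGal p₁).Φ (Datum.zeroGal p₁).B (Datum.zeroGal p₁).divB).Cor411iv
      (ModelFrobenioid.data (Datum.zeroGal p₂).Φ (Datum.zeroGal p₂).B (Datum.zeroGal p₂).divB) Ψ
      (rsParams ((Datum.zeroGal p₁).isFrobenioid_of_isOfFSMType (dZero_isOfFSMType p₁))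
        fun a 𝔭 => PrimarySupp a 𝔭)
      (rsParams ((Datum.zeroGal p₂).isFrobenioid_of_isOfFSMType (dZero_isOfFSMType p₂))
        fun a 𝔭 => PrimarySupp a 𝔭) :=
  cor411iv_padic _ _ (dZero_isOfFSMType p₁) (dZero_isOfFSMType p₂) Ψ _ _

/-- **[FrdI] Cor. 4.11 (i) at THE `C₀`'s, no hypothesis.** [cite: MochizukiFrdI2008, Cor. 4.11 (i) p.91]
[cite: MochizukiFrdII2008, Ex 1.1 (i) p.7] -/
theorem exists_cor411i_czeroGal (Ψ : CZeroGal p₁ ≌ CZeroGal p₂) :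
    ∃ Ψistr : (ModelFrobenioid.data (Datum.zeroGal p₁).Φ (Datum.zeroGal p₁).B (Datum.zeroGal p₁).divB).Istr ≌
        (ModelFrobenioid.data (Datum.zeroGal p₂).Φ (Datum.zeroGal p₂).B (Datum.zeroGal p₂).divB).Istr,
      Ψistr.functor ⋙
            (ModelFrobenioid.data (Datum.zeroGal p₂).Φ (Datum.zeroGal p₂).B (Datum.zeroGal p₂).divB).istrι =
          (ModelFrobenioid.data (Datum.zeroGal p₁).Φ (Datum.zeroGal p₁).B (Datum.zeroGal p₁).divB).istrι ⋙
            Ψ.functor ∧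
        (ModelFrobenioid.data (Datum.zeroGal p₁).Φ (Datum.zeroGal p₁).B (Datum.zeroGal p₁).divB).Cor411i
          (ModelFrobenioid.data (Datum.zeroGal p₂).Φ (Datum.zeroGal p₂).B (Datum.zeroGal p₂).divB) Ψ
          Ψistr.functor :=
  exists_cor411i_padic _ _ (dZero_isOfFSMType p₁) (dZero_isOfFSMType p₂) (dZero_isSlim p₁) (dZero_isSlim p₂) Ψ

end CZero

end PadicFrd

end Literature.AlgebraicGeometry.Frobenioids

end
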